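import Literature.Computability.AlgebraicComplexity.ArithCircuitProofs
import Mathlib.Algebra.MvPolynomial.Degrees
import Mathlib.Data.NNReal.Defs

/-!
# Crux `ZeroOneTransfer` (stmt-ValiantsHypothesis-5066), line `hidden-markov-intertwiner` —
stub `stub_sparsePolyComplexity`: sparse polynomials are cheap

`stub_sparsePolyComplexity`: a polynomial `q ∈ ℝ≥0[τ]` with at most `T` monomials and total
degree at most `T` has `L(q) ≤ 2·T·T + 2·T`, `L` the tree's fan-in-two `complexity` over the
semiring `ℝ≥0` (monotone circuit size; variables and constants are free, Bürgisser 2000, Def. 2.1).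
This is the elementary cost bound of the line's engine `SubMarkovDetDivisionEasy` (forest
polynomials under SPARSE monotone substitutions are division-easy): the substituted data are
charged `Σ_i L(φ i)` by the transport stub `stub_divSubstClosure`, and each `L(φ i)` is bounded here.

## Proof

Write `q = Σ_{d ∈ supp q} monomial d (coeff d q)` (`MvPolynomial.as_sum`).  One addition gate per
summand (`complexity_finset_sum_le`) leaves `L(monomial d c) ≤ 2·T + 1` for `d ∈ supp q`:
`monomial d c = C c · Π_{i ∈ supp d} X_i ^ (d i)` (`MvPolynomial.monomial_eq`), the constant is free,
one product gate joins it, `Π_{i ∈ supp d}` costs `Σ_i L(X_i ^ d i) + #supp d`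
(`complexity_finset_prod_le`), `L(X_i ^ m) ≤ m` (`m` product gates, variables free), and
`Σ_i d i = |d| ≤ deg q ≤ T` (`MvPolynomial.le_totalDegree`), `#supp d ≤ |d|` (every exponent on the
support is `≥ 1`).  Total: `#supp q · (2T + 1) + #supp q ≤ T (2T + 1) + T = 2T² + 2T`.

Helper namespace `SparsePoly`; imports `Literature` and Mathlib only (no `Theses` file). [folklore]
-/

noncomputable section

-- `Summit.ValiantsHypothesis.ValiantsHypothesis.…` is the tree's mandated single-conjunct layout
-- (Sub = Summit), so the duplicated namespace component is intended.
set_option linter.dupNamespace false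

namespace Summit.ValiantsHypothesis.ValiantsHypothesis.Theorems.DivisionGapZeroOneTransfer

open Literature.Computability.AlgebraicComplexity
open MvPolynomial Finset
open scoped NNReal

namespace SparsePoly

variable {τ : Type*}

/-- `L(f ^ m) ≤ m · L(f) + m`: multiply out one factor at a time (`f ^ m = Π_{i < m} f` and
`complexity_finset_prod_le`; Bürgisser 2000, §2.1). [folklore] -/
theorem complexity_pow_le (f : MvPolynomial τ ℝ≥0) (m : ℕ) :
    complexity (f ^ m) ≤ m * complexity f + m := by
  have h : f ^ m = ∏ _i ∈ Finset.range m, f := by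
    rw [Finset.prod_const, Finset.card_range]
  rw [h]
  refine (complexity_finset_prod_le _ _).trans ?_
  rw [Finset.sum_const, Finset.card_range, smul_eq_mul]

/-- Powers of a variable: `L(X_i ^ m) ≤ m` (variables are free). [folklore] -/
theorem complexity_X_pow_le (i : τ) (m : ℕ) :
    complexity ((X i : MvPolynomial τ ℝ≥0) ^ m) ≤ m := by
  refine (complexity_pow_le _ _).trans ?_
  rw [complexity_X_holds i, mul_zero, zero_add]

/-- A finitely supported exponent vector has at most `|d| = Σ_i d i` nonzero entries (each is
`≥ 1`). [folklore] -/
theorem card_support_le_sum (d : τ →₀ ℕ) : d.support.card ≤ d.sum fun _ e => e := by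
  rw [Finsupp.sum, Finset.card_eq_sum_ones]
  exact Finset.sum_le_sum fun i hi => Nat.one_le_iff_ne_zero.mpr (Finsupp.mem_support_iff.mp hi)

/-- The pure power product `Π_{i ∈ supp d} X_i ^ (d i)` costs at most `|d| + #supp d` gates.
[folklore] -/
theorem complexity_prod_X_pow_le (d : τ →₀ ℕ) :
    complexity (∏ i ∈ d.support, (X i : MvPolynomial τ ℝ≥0) ^ d i) ≤
      (d.sum fun _ e => e) + d.support.card := by
  refine (complexity_finset_prod_le _ _).trans ?_
  rw [Finsupp.sum]
  gcongr with i hi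
  exact complexity_X_pow_le i (d i)

/-- One monomial: `L(monomial d c) ≤ 2 |d| + 1` (free constant, one product gate, the power
product). [folklore] -/
theorem complexity_monomial_le (d : τ →₀ ℕ) (c : ℝ≥0) :
    complexity (monomial d c : MvPolynomial τ ℝ≥0) ≤ 2 * (d.sum fun _ e => e) + 1 := by
  have hC : complexity (C c : MvPolynomial τ ℝ≥0) = 0 := complexity_C_holds c
  have hP := complexity_prod_X_pow_le d
  have hc := card_support_le_sum d
  rw [monomial_eq, Finsupp.prod]
  calc complexity (C c * ∏ i ∈ d.support, (X i : MvPolynomial τ ℝ≥0) ^ d i)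
      ≤ complexity (C c : MvPolynomial τ ℝ≥0) +
          complexity (∏ i ∈ d.support, (X i : MvPolynomial τ ℝ≥0) ^ d i) + 1 :=
        complexity_mul_le_holds _ _
    _ ≤ 0 + ((d.sum fun _ e => e) + d.sum fun _ e => e) + 1 := by
        rw [hC]
        gcongr
        exact hP.trans (by gcongr)
    _ = 2 * (d.sum fun _ e => e) + 1 := by ring

/-- A monomial of a polynomial of total degree `≤ T` costs at most `2 T + 1`. [folklore] -/
theorem complexity_monomial_le_of_mem {T : ℕ} {q : MvPolynomial τ ℝ≥0} (hT : q.totalDegree ≤ T)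
    {d : τ →₀ ℕ} (hd : d ∈ q.support) :
    complexity (monomial d (coeff d q) : MvPolynomial τ ℝ≥0) ≤ 2 * T + 1 := by
  have h := (le_totalDegree hd).trans hT
  refine (complexity_monomial_le d _).trans ?_
  gcongr

end SparsePoly

/-- **Sparse polynomials are cheap** (`SparsePolyComplexity`, stub S of line
`hidden-markov-intertwiner`): a polynomial over `ℝ≥0` with at most `T` monomials and total degree
at most `T` has monotone fan-in-two circuit size `L(q) ≤ 2·T·T + 2·T` (sum of its monomials, each of
cost `≤ 2T + 1`, plus one addition gate per monomial). [folklore] -/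
theorem stub_sparsePolyComplexity :
    ∀ (τ : Type) (T : ℕ) (q : MvPolynomial τ NNReal), q.support.card ≤ T → q.totalDegree ≤ T →
      Literature.Computability.AlgebraicComplexity.complexity q ≤ 2 * T * T + 2 * T := by
  intro τ T q hcard hdeg
  calc complexity q = complexity (∑ d ∈ q.support, monomial d (coeff d q)) :=
        congrArg complexity q.as_sum
    _ ≤ ∑ d ∈ q.support, complexity (monomial d (coeff d q)) + q.support.card :=
        complexity_finset_sum_le _ _
    _ ≤ ∑ _d ∈ q.support, (2 * T + 1) + q.support.card := by
        gcongr with d hd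
        exact SparsePoly.complexity_monomial_le_of_mem hdeg hd
    _ = q.support.card * (2 * T + 1) + q.support.card := by rw [Finset.sum_const, smul_eq_mul]
    _ ≤ T * (2 * T + 1) + T := add_le_add (Nat.mul_le_mul_right _ hcard) hcard
    _ = 2 * T * T + 2 * T := by ring

end Summit.ValiantsHypothesis.ValiantsHypothesis.Theorems.DivisionGapZeroOneTransfer
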